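import Literature.NumberTheory.LFunctions.DirichletConvOneChiSum
import HarnessLib

/-!
# `MobiusLadder.LiouvilleNotPPoly` (stmt-QuantumAdvantage-1389), line `Sketch` — stub
`stub_divisorSumHyperbola` (T2b): Dirichlet's hyperbola estimate for `∑_{m ≤ N} ∑_{e ∣ m} χ(e)`

Let `χ ≠ χ₀` be a Dirichlet character mod `q` whose partial sums `∑_{n ≤ M} χ(n)` are bounded in
norm by `B`, and `r(m) = ∑_{e ∣ m} χ(e)`. For integers `1 ≤ Y ≤ N` we prove
`‖∑_{m=1}^{N} r(m) − N·L(1, χ)‖ ≤ 4BN/Y + Y` (`stub_divisorSumHyperbola`), by Dirichlet's hyperbola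
method (the unweighted twin of `Literature/NumberTheory/LFunctions/DirichletConvOneChiSum.lean`,
Montgomery–Vaughan §11.2.1 Exercise 3): writing `∑_{m ≤ N} r(m) = ∑_{de ≤ N} χ(d)`,

* the range `d ≤ Y` is `∑_{d ≤ Y} χ(d)⌊N/d⌋ = N ∑_{d ≤ Y} χ(d)/d + O(Y)` (`0 ≤ N/d − ⌊N/d⌋ < 1`,
  `|χ| ≤ 1`), and `∑_{d ≤ Y} χ(d)/d = L(1, χ) + O(2B/(Y+1))`
  (`DirichletAbel.norm_sum_Icc_div_sub_LFunction_one_le`);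
* the range `d > Y`, summed first over `e` (`e ≤ N/(Y+1)`, else the block `Y < d ≤ N/e` is empty),
  is a sum of `≤ N/(Y+1)` character blocks `∑_{Y < d ≤ N/e} χ(d)`, each of norm `≤ 2B`.

Total: `2BN/(Y+1) + Y + 2BN/(Y+1) ≤ 4BN/Y + Y`. Theorems only; helper lemmas live in the
sub-namespace `Hyperbola`.
-/

set_option linter.dupNamespace false -- D-0017: single-problem summit ⇒ `QuantumAdvantage.QuantumAdvantage` by design

noncomputable section

namespace Summit.QuantumAdvantage.QuantumAdvantage.Theorems.LiouvilleNotPPoly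

open Finset
open Literature.NumberTheory.LFunctions.DirichletAbel

namespace Hyperbola

variable {q : ℕ} (χ : DirichletCharacter ℂ q)

/-! ### The hyperbola rearrangement, split at `Y` -/

/-- The head of the hyperbola sum in the `d`-first order: for `Y ≤ N`,
`∑_{m ≤ N} ∑_{e ∣ m, e ≤ Y} g(e) = ∑_{d ≤ Y} ⌊N/d⌋ • g(d)`. [folklore] -/
theorem sum_Icc_sum_divisors_ite_le {M : Type*} [AddCommMonoid M] (g : ℕ → M) {N Y : ℕ}
    (hYN : Y ≤ N) :
    ∑ m ∈ Icc 1 N, ∑ e ∈ m.divisors, (if e ≤ Y then g e else 0) =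
      ∑ d ∈ Icc 1 Y, (N / d) • g d := by
  have hstep : ∀ m ∈ Icc 1 N, ∑ e ∈ m.divisors, (if e ≤ Y then g e else 0) =
      ∑ i ∈ m.divisorsAntidiagonal, (if i.1 ≤ Y then g i.1 else 0) := by
    intro m _
    rw [Nat.sum_divisorsAntidiagonal (f := fun d _ => if d ≤ Y then g d else 0)]
  rw [sum_congr rfl hstep,
    Literature.NumberTheory.Sieve.SquarefreeSums.sum_Icc_sum_divisorsAntidiagonal
      (fun d _ => if d ≤ Y then g d else 0) N]
  have hIcc : Icc 1 Y = (Icc 1 N).filter (fun d => d ≤ Y) := by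
    ext d; simp only [mem_filter, mem_Icc]; omega
  rw [hIcc, sum_filter]
  refine sum_congr rfl fun d _ => ?_
  by_cases h : d ≤ Y
  · simp only [if_pos h, sum_const, Nat.card_Icc, Nat.add_sub_cancel]
  · simp only [if_neg h, sum_const_zero]

/-- The tail of the hyperbola sum in the `e`-first (swapped) order:
`∑_{m ≤ N} ∑_{d ∣ m, d > Y} g(d) = ∑_{e ≤ N} ∑_{Y < d ≤ N/e} g(d)`. [folklore] -/
theorem sum_Icc_sum_divisors_ite_lt {M : Type*} [AddCommMonoid M] (g : ℕ → M) (N Y : ℕ) :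
    ∑ m ∈ Icc 1 N, ∑ e ∈ m.divisors, (if Y < e then g e else 0) =
      ∑ e ∈ Icc 1 N, ∑ d ∈ (Icc 1 (N / e)).filter (fun d => Y < d), g d := by
  have hstep : ∀ m ∈ Icc 1 N, ∑ e ∈ m.divisors, (if Y < e then g e else 0) =
      ∑ i ∈ m.divisorsAntidiagonal, (if Y < i.2 then g i.2 else 0) := by
    intro m _
    rw [Nat.sum_divisorsAntidiagonal' (f := fun _ d => if Y < d then g d else 0)]
  rw [sum_congr rfl hstep,
    Literature.NumberTheory.Sieve.SquarefreeSums.sum_Icc_sum_divisorsAntidiagonal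
      (fun _ d => if Y < d then g d else 0) N]
  refine sum_congr rfl fun e _ => ?_
  rw [sum_filter]

/-- **Dirichlet's hyperbola rearrangement, split at `Y`**: for `Y ≤ N`,
`∑_{m ≤ N} ∑_{e ∣ m} g(e) = ∑_{d ≤ Y} ⌊N/d⌋ • g(d) + ∑_{e ≤ N} ∑_{Y < d ≤ N/e} g(d)`. [folklore] -/
theorem sum_Icc_sum_divisors_split {M : Type*} [AddCommMonoid M] (g : ℕ → M) {N Y : ℕ}
    (hYN : Y ≤ N) :
    ∑ m ∈ Icc 1 N, ∑ e ∈ m.divisors, g e =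
      ∑ d ∈ Icc 1 Y, (N / d) • g d +
        ∑ e ∈ Icc 1 N, ∑ d ∈ (Icc 1 (N / e)).filter (fun d => Y < d), g d := by
  have hg : ∀ e, g e = (if e ≤ Y then g e else 0) + (if Y < e then g e else 0) := by
    intro e
    by_cases h : e ≤ Y
    · rw [if_pos h, if_neg (not_lt.mpr h), add_zero]
    · rw [if_neg h, if_pos (not_le.mp h), zero_add]
  rw [← sum_Icc_sum_divisors_ite_le g hYN, ← sum_Icc_sum_divisors_ite_lt g N Y, ← sum_add_distrib]
  refine sum_congr rfl fun m _ => ?_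
  rw [← sum_add_distrib]
  exact sum_congr rfl fun e _ => hg e

/-- The split rearrangement for a Dirichlet character:
`∑_{m ≤ N} ∑_{e ∣ m} χ(e) = ∑_{d ≤ Y} ⌊N/d⌋ χ(d) + ∑_{e ≤ N} ∑_{Y < d ≤ N/e} χ(d)`. [folklore] -/
theorem sum_divisorSum_split {N Y : ℕ} (hYN : Y ≤ N) :
    ∑ m ∈ Icc 1 N, ∑ e ∈ m.divisors, χ (e : ZMod q) =
      ∑ d ∈ Icc 1 Y, ((N / d : ℕ) : ℂ) * χ (d : ZMod q) +
        ∑ e ∈ Icc 1 N, ∑ d ∈ (Icc 1 (N / e)).filter (fun d => Y < d), χ (d : ZMod q) := by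
  rw [sum_Icc_sum_divisors_split (fun e => χ (e : ZMod q)) hYN]
  simp only [nsmul_eq_mul]

/-! ### Character blocks -/

/-- `∑_{d=1}^{M} χ(d)` is the partial sum `partialSum χ M`. [folklore] -/
theorem sum_Icc_eq_partialSum (M : ℕ) :
    ∑ d ∈ Icc 1 M, χ (d : ZMod q) = partialSum χ M := by
  rw [sum_Icc_one_eq_sum_range, partialSum]

/-- A character block is a difference of partial sums: for `Y ≤ M`,
`∑_{Y < d ≤ M} χ(d) = partialSum χ M − partialSum χ Y`. [folklore] -/
theorem sum_Icc_filter_lt_eq {Y M : ℕ} (hYM : Y ≤ M) :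
    ∑ d ∈ (Icc 1 M).filter (fun d => Y < d), χ (d : ZMod q) =
      partialSum χ M - partialSum χ Y := by
  rw [eq_sub_iff_add_eq, ← sum_Icc_eq_partialSum, ← sum_Icc_eq_partialSum,
    ← sum_filter_add_sum_filter_not (Icc 1 M) (fun d => Y < d)]
  congr 1
  refine sum_congr ?_ fun _ _ => rfl
  ext d; simp only [mem_filter, mem_Icc, not_lt]; omega

/-- Character blocks are bounded by `2B`: `‖∑_{Y < d ≤ M} χ(d)‖ ≤ 2B`. [folklore] -/
theorem norm_sum_Icc_filter_lt_le {B : ℝ} (hB : ∀ n, ‖partialSum χ n‖ ≤ B) (Y M : ℕ) :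
    ‖∑ d ∈ (Icc 1 M).filter (fun d => Y < d), χ (d : ZMod q)‖ ≤ 2 * B := by
  have hB0 : 0 ≤ B := (norm_nonneg _).trans (hB 0)
  rcases le_or_gt Y M with hYM | hMY
  · rw [sum_Icc_filter_lt_eq χ hYM]
    calc ‖partialSum χ M - partialSum χ Y‖
        ≤ ‖partialSum χ M‖ + ‖partialSum χ Y‖ := norm_sub_le _ _
      _ ≤ B + B := add_le_add (hB M) (hB Y)
      _ = 2 * B := by ring
  · have : (Icc 1 M).filter (fun d => Y < d) = ∅ := by
      ext d; simp only [mem_filter, mem_Icc, Finset.notMem_empty, iff_false]; omega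
    rw [this, sum_empty, norm_zero]; positivity

/-! ### The tail `d > Y` -/

/-- For `e > N/(Y+1)` the block `Y < d ≤ N/e` is empty. [folklore] -/
theorem filter_Icc_div_eq_empty {N Y e : ℕ} (he : N / (Y + 1) < e) :
    (Icc 1 (N / e)).filter (fun d => Y < d) = ∅ := by
  rw [Finset.filter_eq_empty_iff]
  intro d hd hYd
  rw [mem_Icc] at hd
  have he0 : 0 < e := (Nat.zero_le _).trans_lt he
  have h1 : (Y + 1) * e ≤ N := (Nat.le_div_iff_mul_le he0).mp (by omega)
  have h2 : N < e * (Y + 1) := (Nat.div_lt_iff_lt_mul (Nat.succ_pos Y)).mp he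
  rw [mul_comm] at h2
  omega

/-- The tail only involves `e ≤ N/(Y+1)`:
`∑_{e ≤ N} ∑_{Y < d ≤ N/e} g(d) = ∑_{e ≤ N/(Y+1)} ∑_{Y < d ≤ N/e} g(d)`. [folklore] -/
theorem hyperbolaTail_eq {M : Type*} [AddCommMonoid M] (g : ℕ → M) (N Y : ℕ) :
    ∑ e ∈ Icc 1 N, ∑ d ∈ (Icc 1 (N / e)).filter (fun d => Y < d), g d =
      ∑ e ∈ Icc 1 (N / (Y + 1)), ∑ d ∈ (Icc 1 (N / e)).filter (fun d => Y < d), g d := by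
  refine (sum_subset (fun e he => ?_) (fun e he he' => ?_)).symm
  · rw [mem_Icc] at he ⊢
    exact ⟨he.1, he.2.trans (Nat.div_le_self N (Y + 1))⟩
  · rw [mem_Icc] at he he'
    have hlt : N / (Y + 1) < e := by omega
    rw [filter_Icc_div_eq_empty hlt, sum_empty]

/-- **The tail bound**: `‖∑_{e ≤ N} ∑_{Y < d ≤ N/e} χ(d)‖ ≤ 2B · ⌊N/(Y+1)⌋`. [folklore] -/
theorem norm_hyperbolaTail_le {B : ℝ} (hB : ∀ n, ‖partialSum χ n‖ ≤ B) (N Y : ℕ) :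
    ‖∑ e ∈ Icc 1 N, ∑ d ∈ (Icc 1 (N / e)).filter (fun d => Y < d), χ (d : ZMod q)‖ ≤
      2 * B * ((N / (Y + 1) : ℕ) : ℝ) := by
  rw [hyperbolaTail_eq (fun d => χ (d : ZMod q)) N Y]
  refine (norm_sum_le _ _).trans ?_
  calc ∑ e ∈ Icc 1 (N / (Y + 1)), ‖∑ d ∈ (Icc 1 (N / e)).filter (fun d => Y < d), χ (d : ZMod q)‖
      ≤ ∑ e ∈ Icc 1 (N / (Y + 1)), 2 * B :=
        sum_le_sum fun e _ => norm_sum_Icc_filter_lt_le χ hB Y (N / e)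
    _ = 2 * B * ((N / (Y + 1) : ℕ) : ℝ) := by
        simp only [sum_const, Nat.card_Icc, Nat.add_sub_cancel, nsmul_eq_mul]
        ring

/-! ### The head `d ≤ Y` -/

/-- **The floor error in the head**: `‖∑_{d ≤ Y} ⌊N/d⌋ χ(d) − N ∑_{d ≤ Y} χ(d)/d‖ ≤ Y`
(`0 ≤ N/d − ⌊N/d⌋ < 1` and `|χ(d)| ≤ 1`). [folklore] -/
theorem norm_head_floor_sub_le (N Y : ℕ) :
    ‖(∑ d ∈ Icc 1 Y, ((N / d : ℕ) : ℂ) * χ (d : ZMod q)) -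
        (N : ℂ) * ∑ d ∈ Icc 1 Y, χ (d : ZMod q) / (d : ℂ)‖ ≤ (Y : ℝ) := by
  rw [mul_sum, ← sum_sub_distrib]
  have hterm : ∀ d ∈ Icc 1 Y,
      ‖((N / d : ℕ) : ℂ) * χ (d : ZMod q) - (N : ℂ) * (χ (d : ZMod q) / (d : ℂ))‖ ≤ 1 := by
    intro d hd
    rw [mem_Icc] at hd
    have hd0 : (0 : ℝ) < d := by exact_mod_cast hd.1
    have e : ((N / d : ℕ) : ℂ) * χ (d : ZMod q) - (N : ℂ) * (χ (d : ZMod q) / (d : ℂ)) =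
        ((((N / d : ℕ) : ℝ) - (N : ℝ) / (d : ℝ) : ℝ) : ℂ) * χ (d : ZMod q) := by
      push_cast
      ring
    rw [e, norm_mul, Complex.norm_real, Real.norm_eq_abs]
    have h1 : ‖χ (d : ZMod q)‖ ≤ 1 := χ.norm_le_one _
    have h2 : |((N / d : ℕ) : ℝ) - (N : ℝ) / (d : ℝ)| ≤ 1 := by
      have hle : ((N / d : ℕ) : ℝ) ≤ (N : ℝ) / (d : ℝ) := Nat.cast_div_le
      have hlt : (N : ℝ) < ((N / d : ℕ) : ℝ) * d + d := by
        exact_mod_cast Nat.lt_div_mul_add (a := N) hd.1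
      have key : (N : ℝ) / d ≤ ((N / d : ℕ) : ℝ) + 1 := by
        rw [div_le_iff₀ hd0, add_mul, one_mul]
        exact hlt.le
      rw [abs_sub_comm, abs_of_nonneg (sub_nonneg.mpr hle)]
      linarith
    calc |((N / d : ℕ) : ℝ) - (N : ℝ) / (d : ℝ)| * ‖χ (d : ZMod q)‖
        ≤ 1 * 1 := mul_le_mul h2 h1 (norm_nonneg _) zero_le_one
      _ = 1 := one_mul 1
  refine (norm_sum_le _ _).trans ((sum_le_sum hterm).trans (le_of_eq ?_))
  rw [sum_const, Nat.card_Icc, Nat.add_sub_cancel, nsmul_eq_mul, mul_one]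

end Hyperbola

/-- **STUB T2b · `stub_divisorSumHyperbola`** — DIRICHLET'S HYPERBOLA ESTIMATE: for a non-principal
character `χ` mod `q` whose partial sums are bounded by `B`, and `1 ≤ Y ≤ N`,
`‖∑_{m=1}^{N} ∑_{e ∣ m} χ(e) − N·L(1,χ)‖ ≤ 4BN/Y + Y`
(`∑_m ∑_{e∣m} χ(e) = ∑_{d ≤ Y} χ(d)⌊N/d⌋ + ∑_{e} ∑_{Y < d ≤ N/e} χ(d)`; the head is
`N ∑_{d ≤ Y} χ(d)/d + O(Y)` with `∑_{d ≤ Y} χ(d)/d = L(1,χ) + O(2B/(Y+1))`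
(`DirichletAbel.norm_sum_Icc_div_sub_LFunction_one_le`); the tail has `≤ N/(Y+1)` blocks of norm
`≤ 2B`). Montgomery–Vaughan, *Multiplicative Number Theory I*, §11.2.1 Exercise 3 (unweighted). -/
theorem stub_divisorSumHyperbola :
    ∀ (q : ℕ) [NeZero q] (χ : DirichletCharacter ℂ q), χ ≠ 1 → ∀ B : ℝ,
      (∀ M : ℕ, ‖Literature.NumberTheory.LFunctions.DirichletAbel.partialSum χ M‖ ≤ B) →
      ∀ N Y : ℕ, 1 ≤ Y → Y ≤ N →
        ‖(∑ m ∈ Finset.Icc 1 N, ∑ e ∈ m.divisors, χ e) - (N : ℂ) * χ.LFunction 1‖ ≤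
          4 * B * N / Y + Y := by
  intro q _ χ hχ B hB N Y hY hYN
  have hB0 : 0 ≤ B := (norm_nonneg _).trans (hB 0)
  have hY0 : (0 : ℝ) < Y := by exact_mod_cast hY
  rw [Hyperbola.sum_divisorSum_split χ hYN]
  set head : ℂ := ∑ d ∈ Icc 1 Y, ((N / d : ℕ) : ℂ) * χ (d : ZMod q) with hhead
  set tail : ℂ := ∑ e ∈ Icc 1 N, ∑ d ∈ (Icc 1 (N / e)).filter (fun d => Y < d), χ (d : ZMod q)
    with htail
  set AY : ℂ := ∑ d ∈ Icc 1 Y, χ (d : ZMod q) / (d : ℂ) with hAY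
  set L : ℂ := χ.LFunction 1 with hL
  have e1 : ‖head - (N : ℂ) * AY‖ ≤ Y := Hyperbola.norm_head_floor_sub_le χ N Y
  have e2 : ‖AY - L‖ ≤ 2 * B / ((Y : ℝ) + 1) := norm_sum_Icc_div_sub_LFunction_one_le χ hχ hB Y
  have e3 : ‖tail‖ ≤ 2 * B * ((N / (Y + 1) : ℕ) : ℝ) := Hyperbola.norm_hyperbolaTail_le χ hB N Y
  have hN : ‖(N : ℂ) * (AY - L)‖ ≤ N * (2 * B / ((Y : ℝ) + 1)) := by
    rw [norm_mul, Complex.norm_natCast]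
    exact mul_le_mul_of_nonneg_left e2 (Nat.cast_nonneg N)
  have hdiv : ((N / (Y + 1) : ℕ) : ℝ) ≤ (N : ℝ) / Y :=
    calc ((N / (Y + 1) : ℕ) : ℝ) ≤ (N : ℝ) / ((Y + 1 : ℕ) : ℝ) := Nat.cast_div_le
      _ ≤ (N : ℝ) / Y := by
        apply div_le_div_of_nonneg_left (Nat.cast_nonneg N) hY0
        push_cast
        linarith
  have hfrac : 2 * B / ((Y : ℝ) + 1) ≤ 2 * B / Y :=
    div_le_div_of_nonneg_left (by positivity) hY0 (by linarith)
  have hdecomp : head + tail - (N : ℂ) * L =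
      (head - (N : ℂ) * AY) + (N : ℂ) * (AY - L) + tail := by ring
  rw [hdecomp]
  calc ‖(head - (N : ℂ) * AY) + (N : ℂ) * (AY - L) + tail‖
      ≤ ‖head - (N : ℂ) * AY‖ + ‖(N : ℂ) * (AY - L)‖ + ‖tail‖ := norm_add₃_le
    _ ≤ Y + N * (2 * B / ((Y : ℝ) + 1)) + 2 * B * ((N / (Y + 1) : ℕ) : ℝ) :=
        add_le_add (add_le_add e1 hN) e3
    _ ≤ Y + N * (2 * B / (Y : ℝ)) + 2 * B * ((N : ℝ) / Y) :=
        add_le_add (add_le_add le_rfl (mul_le_mul_of_nonneg_left hfrac (Nat.cast_nonneg N)))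
          (mul_le_mul_of_nonneg_left hdiv (by positivity))
    _ = 4 * B * (N : ℝ) / (Y : ℝ) + (Y : ℝ) := by ring

end Summit.QuantumAdvantage.QuantumAdvantage.Theorems.LiouvilleNotPPoly

end
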